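import Literature.NumberTheory.Automorphic.Liu2021.LemD1BinaryIsotropyOfPlace
import Literature.NumberTheory.Automorphic.Liu2021.Def412AdmissibleIffParity
import Literature.NumberTheory.Automorphic.UnitaryGroupFrameSubform
import Literature.NumberTheory.QuadraticForms.LandherrHermitianPlanes
import Mathlib.Analysis.Complex.Order
import HarnessLib

/-!
# [Liu2021, App. D §D.3] the signature clause «(1,1) at `τ₁`, (2,0) elsewhere» counted over the real places of `F⁺`:
# the anisotropic finite places of the rank-2 hermitian space have the parity of `[F⁺:ℚ] − 1`

Topic `NumberTheory/Automorphic/Liu2021`; namespace `Literature.NumberTheory.Automorphic.Liu2021.RemD5`.  KERNEL ONLY: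
theorems, no definition, no named fact, no `sorry`.  Nothing of [Liu2021] is asserted; ORIENTATION-FREE (no label `μ`,
no `ε`, no Rem. D.5 text is mentioned — cell hodgecm-mathlib flag «F-orient»).

Setting: a CM field `F` with maximal totally real subfield `F⁺` (Mathlib `maximalRealSubfield`, `IsCMField.complexConj`),
a complex embedding `ι₁ : F →+* ℂ`, and a real diagonal Gram matrix `diag(dJ₀, dJ₁)` (`c dJᵢ = dJᵢ ≠ 0`) carrying the
SIGNATURE CLAUSE of [Liu2021, App. D §D.3 (l. 5355)] in the cell's registered form `_hsig`:
`(∃ T⋆ ∈ GL₂(ℂ), ᵗT̄⋆ · diag(ι₁ dJ) · T⋆ = diag(1, −1)) ∧ ∀ τ′, mk τ′ ≠ mk ι₁ → diag(τ′ dJ) positive definite`.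

* §1 `re_apply_mul_lt_zero_of_formCongr_eq` — the `(1,1)` clause forces `ι₁(dJ₀dJ₁) < 0` (determinants:
  `|det T⋆|² · ι₁(dJ₀dJ₁) = −1`, tree `det_formCongr`); `re_apply_mul_pos_of_posDef` — positive definiteness at `τ′` forces
  `τ′(dJ₀dJ₁) > 0` (Mathlib `posDef_diagonal_iff`).
* §2 **`setOf_embedding_pos_eq_compl`** — the real places `w` of `F⁺` with `w(dJ₀dJ₁) > 0` (the definite places of the
  plane) are exactly those other than the restriction `w₁` of `ι₁`; **`ncard_setOf_embedding_pos`** — there are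
  `[F⁺:ℚ] − 1` of them.
* §3 **`even_ncard_not_isIsotropic_add_finrank_sub_one`** — with ★ `LemD1OfPlace.even_ncard_not_isIsotropic_add_ncard_pos`
  (Hilbert reciprocity for `(δ², −dJ₀dJ₁)`): the number of finite places `v` of `F⁺` at which the hermitian plane
  `(F_v², diag(dJ) ⊗ 1)` of the local standing data is ANISOTROPIC (`¬ LemD1.IsIsotropic`) has the parity of `[F⁺:ℚ] − 1`;
  `even_ncard_not_isIsotropic_iff` — equivalently `#{v anisotropic}` is even iff `[F⁺:ℚ]` is odd (so for `[F⁺:ℚ]` even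
  some finite place is anisotropic).

Consumer: the d6 line (`Cruxes/HLiu418/Lines/d6_cm_curve`), card v3.6 (E′): the set of finite places where the companion
label of [Liu2021, Lem. D.1 (4)] changes `ε` is the anisotropic set, and its parity is what Rem. D.5's branch reads.  HC_CM
is proved only modulo the 7 printed citations until rung 0 closes; this file proves no cell binder.

## References
* [Liu2021] Y. Liu, Camb. J. Math. 9 (2021) = arXiv:2102.11518, App. D §D.3 (l. 5353–5359: «signature `(1,1)` at `τ₁`
  and `(2,0)` at the other places»), Lemma D.1 (4) (l. 5235), Rem. D.5 (l. 5396–5405).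
* [Landherr1936HermitianForms] W. Landherr, Abh. Math. Sem. Hamburg 11 (1936) 245–248 (local invariants of hermitian forms).
* [Omeara1963] O. T. O'Meara, *Introduction to Quadratic Forms* (1963), §71 Thm. 71:18.
-/

set_option autoImplicit false

noncomputable section

open scoped Matrix MatrixGroups ComplexOrder
open NumberField IsDedekindDomain
open Literature.NumberTheory.Automorphic.UnitaryGroup

namespace Literature.NumberTheory.Automorphic.Liu2021.RemD5

variable (L : Type) [Field L] [NumberField L] [IsCMField L]

/-! ## §1 The two halves of the signature clause, read on `dJ₀ dJ₁` -/

omit [NumberField L] [IsCMField L] in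
/-- **Signature `(1,1)` at `ι₁` ⇒ `ι₁(dJ₀dJ₁)` is a negative real**: taking determinants in
`ᵗT̄⋆ · diag(ι₁ dJ₀, ι₁ dJ₁) · T⋆ = diag(1, −1)` gives `|det T⋆|² · ι₁(dJ₀ dJ₁) = −1`.
[cite: Liu2021, App. D §D.3 (l. 5355)] -/
theorem re_apply_mul_lt_zero_of_formCongr_eq (ι₁ : L →+* ℂ) (dJ : Fin 2 → L)
    (h : ∃ Tstar : GL (Fin 2) ℂ,
      formCongr (starRingEnd ℂ) Tstar ((Matrix.diagonal dJ).map ι₁) = Matrix.diagonal ![(1 : ℂ), -1]) :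
    (ι₁ (dJ 0 * dJ 1)).re < 0 ∧ (ι₁ (dJ 0 * dJ 1)).im = 0 := by
  obtain ⟨T, hT⟩ := h
  have hdet := congrArg Matrix.det hT
  rw [det_formCongr, Matrix.diagonal_map (map_zero _), Matrix.det_diagonal, Matrix.det_diagonal,
    Fin.prod_univ_two, Fin.prod_univ_two] at hdet
  simp only [Matrix.cons_val_zero, Matrix.cons_val_one, one_mul] at hdet
  -- `hdet : conj (det T⋆) * (ι₁ dJ₀ * ι₁ dJ₁) * det T⋆ = -1`
  have hT0 : (T : Matrix (Fin 2) (Fin 2) ℂ).det ≠ 0 :=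
    ((Matrix.isUnit_iff_isUnit_det _).1 (Units.isUnit T)).ne_zero
  have hn : (0 : ℝ) < Complex.normSq (T : Matrix (Fin 2) (Fin 2) ℂ).det := Complex.normSq_pos.2 hT0
  have hns : ((Complex.normSq (T : Matrix (Fin 2) (Fin 2) ℂ).det : ℝ) : ℂ) ≠ 0 :=
    Complex.ofReal_ne_zero.2 hn.ne'
  have h2 : ((Complex.normSq (T : Matrix (Fin 2) (Fin 2) ℂ).det : ℝ) : ℂ) * (ι₁ (dJ 0) * ι₁ (dJ 1)) = -1 := by
    rw [Complex.normSq_eq_conj_mul_self]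
    linear_combination hdet
  have key : ι₁ (dJ 0 * dJ 1) = (-1 : ℂ) / (Complex.normSq (T : Matrix (Fin 2) (Fin 2) ℂ).det : ℝ) := by
    rw [map_mul, eq_div_iff hns, mul_comm]
    exact h2
  rw [key, Complex.div_ofReal_re, Complex.div_ofReal_im, Complex.neg_re, Complex.one_re, Complex.neg_im,
    Complex.one_im, neg_zero, zero_div]
  exact ⟨div_neg_of_neg_of_pos (by norm_num) hn, rfl⟩

omit [NumberField L] [IsCMField L] in
/-- **Positive definiteness at `τ′` ⇒ `τ′(dJ₀dJ₁)` is a positive real** (diagonal entries of a positive definite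
diagonal matrix are positive). [cite: Liu2021, App. D §D.3 (l. 5355)] -/
theorem re_apply_mul_pos_of_posDef (τ : L →+* ℂ) (dJ : Fin 2 → L) (h : ((Matrix.diagonal dJ).map τ).PosDef) :
    0 < (τ (dJ 0 * dJ 1)).re ∧ (τ (dJ 0 * dJ 1)).im = 0 := by
  rw [Matrix.diagonal_map (map_zero _), Matrix.posDef_diagonal_iff] at h
  have h0 := Complex.pos_iff.1 (h 0)
  have h1 := Complex.pos_iff.1 (h 1)
  rw [map_mul]
  simp only [Complex.mul_re, Complex.mul_im, ← h0.2, ← h1.2, mul_zero, zero_mul, sub_zero, add_zero]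
  exact ⟨mul_pos h0.1 h1.1, trivial⟩

/-! ## §2 The definite real places of the plane are the places other than `ι₁|_{F⁺}` -/

variable {L} in
omit [NumberField L] [IsCMField L] in
/-- For `t ∈ F⁺` and a complex embedding `τ` of `F`: the real embedding of the place `w = (mk τ)|_{F⁺}` takes the
value `Re τ(t)` at `t` (every place of the totally real `F⁺` is real). [folklore] -/
private theorem embedding_of_isReal_comap_eq (τ : L →+* ℂ) (t : maximalRealSubfield L)
    (hw : ((InfinitePlace.mk τ).comap (algebraMap (maximalRealSubfield L) L)).IsReal) :
    InfinitePlace.embedding_of_isReal hw t = (τ (t : L)).re := by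
  have h := InfinitePlace.embedding_of_isReal_apply hw t
  rcases InfinitePlace.embedding_mk_eq (τ.comp (algebraMap (maximalRealSubfield L) L)) with h' | h'
  · have h'' : InfinitePlace.embedding ((InfinitePlace.mk τ).comap (algebraMap (maximalRealSubfield L) L)) =
        τ.comp (algebraMap (maximalRealSubfield L) L) := h'
    rw [h'', RingHom.comp_apply] at h
    have hre := congrArg Complex.re h
    rw [Complex.ofReal_re] at hre
    exact hre
  · have h'' : InfinitePlace.embedding ((InfinitePlace.mk τ).comap (algebraMap (maximalRealSubfield L) L)) =
        ComplexEmbedding.conjugate (τ.comp (algebraMap (maximalRealSubfield L) L)) := h'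
    rw [h'', ComplexEmbedding.conjugate_coe_eq, RingHom.comp_apply] at h
    have hre := congrArg Complex.re h
    rw [Complex.ofReal_re, Complex.conj_re] at hre
    exact hre

omit [IsCMField L] in
/-- **The definite real places are the places other than `w₁ = ι₁|_{F⁺}`**: under the signature clause, a real
place `w` of `F⁺` has `w(dJ₀ dJ₁) > 0` iff `w ≠ w₁`. [cite: Liu2021, App. D §D.3 (l. 5355)] -/
theorem setOf_embedding_pos_eq_compl (ι₁ : L →+* ℂ) (dJ : Fin 2 → L) (t : maximalRealSubfield L)
    (ht : (t : L) = dJ 0 * dJ 1)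
    (hsig : (∃ Tstar : GL (Fin 2) ℂ,
        formCongr (starRingEnd ℂ) Tstar ((Matrix.diagonal dJ).map ι₁) = Matrix.diagonal ![(1 : ℂ), -1]) ∧
      ∀ τ' : L →+* ℂ, InfinitePlace.mk τ' ≠ InfinitePlace.mk ι₁ → ((Matrix.diagonal dJ).map τ').PosDef) :
    {w : InfinitePlace (maximalRealSubfield L) | ∃ hw : w.IsReal, 0 < InfinitePlace.embedding_of_isReal hw t} =
      {(InfinitePlace.mk ι₁).comap (algebraMap (maximalRealSubfield L) L)}ᶜ := by
  ext w
  simp only [Set.mem_setOf_eq, Set.mem_compl_iff, Set.mem_singleton_iff]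
  constructor
  · rintro ⟨hw, hpos⟩ rfl
    rw [embedding_of_isReal_comap_eq ι₁ t hw, ht] at hpos
    exact (lt_asymm hpos) (re_apply_mul_lt_zero_of_formCongr_eq L ι₁ dJ hsig.1).1
  · intro hne
    have hw : w.IsReal := IsTotallyReal.isReal w
    -- a complex embedding `τ` of `F` extending the real embedding of `w`
    obtain ⟨τ, hτ⟩ := QuadraticForms.Landherr.exists_embedding_extending L (InfinitePlace.embedding_of_isReal hw)
    have hwτ : (InfinitePlace.mk τ).comap (algebraMap (maximalRealSubfield L) L) = w := by
      rw [InfinitePlace.comap_mk]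
      have hcomp : τ.comp (algebraMap (maximalRealSubfield L) L) = InfinitePlace.embedding w := by
        ext y
        rw [RingHom.comp_apply, ← InfinitePlace.embedding_of_isReal_apply hw]
        exact hτ y
      rw [hcomp, InfinitePlace.mk_embedding]
    have hτ1 : InfinitePlace.mk τ ≠ InfinitePlace.mk ι₁ := by
      intro h
      exact hne (by rw [← hwτ, h])
    have hpos := (re_apply_mul_pos_of_posDef L τ dJ (hsig.2 τ hτ1)).1
    refine ⟨hw, ?_⟩
    have hval : (τ (t : L)).re = InfinitePlace.embedding_of_isReal hw t := by
      rw [hτ t, Complex.ofReal_re]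
    rw [← hval, ht]
    exact hpos

omit [IsCMField L] in
/-- **There are exactly `[F⁺:ℚ] − 1` definite real places.** [cite: Liu2021, App. D §D.3 (l. 5355)] -/
theorem ncard_setOf_embedding_pos (ι₁ : L →+* ℂ) (dJ : Fin 2 → L) (t : maximalRealSubfield L)
    (ht : (t : L) = dJ 0 * dJ 1)
    (hsig : (∃ Tstar : GL (Fin 2) ℂ,
        formCongr (starRingEnd ℂ) Tstar ((Matrix.diagonal dJ).map ι₁) = Matrix.diagonal ![(1 : ℂ), -1]) ∧
      ∀ τ' : L →+* ℂ, InfinitePlace.mk τ' ≠ InfinitePlace.mk ι₁ → ((Matrix.diagonal dJ).map τ').PosDef) :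
    {w : InfinitePlace (maximalRealSubfield L) | ∃ hw : w.IsReal, 0 < InfinitePlace.embedding_of_isReal hw t}.ncard =
      Module.finrank ℚ (maximalRealSubfield L) - 1 := by
  classical
  rw [setOf_embedding_pos_eq_compl L ι₁ dJ t ht hsig, Set.ncard_compl, Set.ncard_singleton, Nat.card_eq_fintype_card,
    InfinitePlace.card_eq_nrRealPlaces_add_nrComplexPlaces, IsTotallyReal.nrComplexPlaces_eq_zero, add_zero,
    ← IsTotallyReal.finrank]

/-! ## §3 The parity of the anisotropic finite places -/

/-- **The anisotropic finite places of `(F_v², diag(dJ) ⊗ 1)` have the parity of `[F⁺:ℚ] − 1`** (signature clause +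
Hilbert reciprocity for `(δ², −dJ₀dJ₁)`, ★ `LemD1OfPlace.even_ncard_not_isIsotropic_add_ncard_pos`); the local standing data are
those of `LemD1OfPlace.standingData` for any purely imaginary `δ ≠ 0` of `F` (only its square, totally negative, enters).
[cite: Liu2021, App. D §D.3 (l. 5355) and Lemma D.1 (4) (l. 5235)] [cite: Omeara1963, §71 Thm. 71:18] -/
theorem even_ncard_not_isIsotropic_add_finrank_sub_one (ι₁ : L →+* ℂ) (dJ : Fin 2 → L)
    (hdJ : ∀ i, IsCMField.complexConj L (dJ i) = dJ i) (hdJ0 : ∀ i, dJ i ≠ 0)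
    (hsig : (∃ Tstar : GL (Fin 2) ℂ,
        formCongr (starRingEnd ℂ) Tstar ((Matrix.diagonal dJ).map ι₁) = Matrix.diagonal ![(1 : ℂ), -1]) ∧
      ∀ τ' : L →+* ℂ, InfinitePlace.mk τ' ≠ InfinitePlace.mk ι₁ → ((Matrix.diagonal dJ).map τ').PosDef)
    {δ : L} (hcδ : IsCMField.complexConj L δ = -δ) (hδ : δ ≠ 0)
    (hJh : ((Matrix.diagonal dJ).map (IsCMField.complexConj L))ᵀ = Matrix.diagonal dJ) (hJdet : (Matrix.diagonal dJ).det ≠ 0) :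
    Even ({v : HeightOneSpectrum (𝓞 (maximalRealSubfield L)) |
        ¬ LemD1.IsIsotropic (LemD1OfPlace.standingData L v (IsCMField.complexConj L) 2 (Matrix.diagonal dJ) hcδ hδ le_rfl
          hJh hJdet)}.ncard + (Module.finrank ℚ (maximalRealSubfield L) - 1)) := by
  -- the real diagonal `t` with `diag(dJ) = diag(t) ⊗ 1`
  let t : Fin 2 → maximalRealSubfield L := fun i => ⟨dJ i, (IsCMField.complexConj_eq_self_iff (K := L) (dJ i)).1 (hdJ i)⟩
  have hJ : Matrix.diagonal dJ = (Matrix.diagonal t).map (algebraMap (maximalRealSubfield L) L) := by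
    rw [Matrix.diagonal_map (map_zero _)]
    rfl
  have ht : ∀ i, t i ≠ 0 := fun i h => hdJ0 i (congrArg Subtype.val h)
  -- `d := δ²`, totally negative
  let d : maximalRealSubfield L :=
    ⟨δ * δ, (IsCMField.complexConj_eq_self_iff (K := L) (δ * δ)).1 (by rw [map_mul, hcδ, neg_mul_neg])⟩
  have hd : δ * δ = algebraMap (maximalRealSubfield L) L d := rfl
  have hdneg : ∀ (w : InfinitePlace (maximalRealSubfield L)) (hw : w.IsReal), InfinitePlace.embedding_of_isReal hw d < 0 :=
    fun w hw => embedding_of_isReal_lt_zero_of_coe_eq_mul_self hcδ hδ rfl w hw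
  have hpar := LemD1OfPlace.even_ncard_not_isIsotropic_add_ncard_pos L (IsCMField.complexConj L) hcδ hδ t hJ hJh hJdet hd
    ht hdneg
  rwa [ncard_setOf_embedding_pos L ι₁ dJ (t 0 * t 1) (by rfl) hsig] at hpar

/-- … equivalently: the number of anisotropic finite places is even iff `[F⁺:ℚ]` is odd (so for `[F⁺:ℚ]` even the
plane is anisotropic at some finite place). [cite: Liu2021, App. D §D.3 (l. 5355) and Lemma D.1 (4) (l. 5235)] -/
theorem even_ncard_not_isIsotropic_iff (ι₁ : L →+* ℂ) (dJ : Fin 2 → L)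
    (hdJ : ∀ i, IsCMField.complexConj L (dJ i) = dJ i) (hdJ0 : ∀ i, dJ i ≠ 0)
    (hsig : (∃ Tstar : GL (Fin 2) ℂ,
        formCongr (starRingEnd ℂ) Tstar ((Matrix.diagonal dJ).map ι₁) = Matrix.diagonal ![(1 : ℂ), -1]) ∧
      ∀ τ' : L →+* ℂ, InfinitePlace.mk τ' ≠ InfinitePlace.mk ι₁ → ((Matrix.diagonal dJ).map τ').PosDef)
    {δ : L} (hcδ : IsCMField.complexConj L δ = -δ) (hδ : δ ≠ 0)
    (hJh : ((Matrix.diagonal dJ).map (IsCMField.complexConj L))ᵀ = Matrix.diagonal dJ) (hJdet : (Matrix.diagonal dJ).det ≠ 0) :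
    Even {v : HeightOneSpectrum (𝓞 (maximalRealSubfield L)) |
        ¬ LemD1.IsIsotropic (LemD1OfPlace.standingData L v (IsCMField.complexConj L) 2 (Matrix.diagonal dJ) hcδ hδ le_rfl
          hJh hJdet)}.ncard ↔ Odd (Module.finrank ℚ (maximalRealSubfield L)) := by
  have h := even_ncard_not_isIsotropic_add_finrank_sub_one L ι₁ dJ hdJ hdJ0 hsig hcδ hδ hJh hJdet
  have hd : 1 ≤ Module.finrank ℚ (maximalRealSubfield L) := Module.finrank_pos
  rw [Nat.even_add, Nat.even_sub hd] at h
  rw [h, iff_false_right Nat.not_even_one, Nat.not_even_iff_odd]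

end Literature.NumberTheory.Automorphic.Liu2021.RemD5

end
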